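import Summits.QuantumFields.YangMills.Theorems.UnitScaleTiltHistoryTailLaneTailInt

/-!
# Route `SmallFieldWidening`, crux r3 `LargeFieldMassRefinementTail` (stmt-QuantumFields-22884), line `birth`:
# the AVERAGED-HEIGHT TAIL PACKAGE from the neighbouring route's K2 frontier (support file; the crux stays open)

Width seat `ym-line-sfw-p2-w3` (2026-08-27).  WHY.  The line's one open stub `stub_perPlaquetteTail` (skeleton v2) is a per-plaquette
large-field Gibbs tail for BLOCK-AVERAGED `SU(2)` plaquettes — the located, unprinted renormalisation-group content it shares with crux K2
`HistoryTail` / K2-L `HistoryTailL` of route `UnitScaleTilt` (stmt-QuantumFields-18916 / 19936).  Sibling seat w2's level-shift bridge reduces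
the crux r3 BY NAME to the PER-FAMILY averaged-height package

  `AvgTailPkg := ∀ L, ∃ b₀ p₀ γ₁, 0 < b₀ ∧ 2 < p₀ ∧ 0 < γ₁ ∧ γ₁ ≤ 1 ∧ ∀ F γ, F.L = L → 0 < γ → γ ≤ γ₁ → AveragedTailAt F γ b₀ p₀`

(verbatim the hypothesis of the landed `unitScaleTilt_historyTail_of_averagedTail`; no uniformity of constants in the family is needed,
because run `K` of `F.refine n` at `γL^{-n}` is run `n + K` of `F` with `n` free top steps).  THIS FILE supplies that package from the
K2 programme's FRONTIER OBJECTS, so that r3 closes the hour K2's frontier closes: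

* `averagedTailPkg_of_perPlaquetteHighL` — the THRESHOLD-FORM per-plaquette high tail (the common conclusion shape of the tree's
  `HistoryTailLaneTail.perPlaquetteHighL_of_laneRecords` and `HistoryTailLaneTailInt.perPlaquetteHighL_of_intCoreRec`: for every odd `L > 1`
  and all thresholds `(b₁, p₁)` a profile beyond them, collar exponents `(r₀, κ)` with `p₀ > 1 + 3r₀/2`, a small-factor constant `c`, a
  coupling threshold `γ₁ ≤ 1`, and per family/coupling a height `j₀` and constants `(C, A)` bounding the Gibbs tail of every averaged
  plaquette at the heights `j > j₀` by `C·β^A·exp(−c·p² + κ·x^{2+3r₀})`) ⇒ `AvgTailPkg`.  Proof = the tail chain of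
  `historyTailL_of_intCoreRec` stopped one step early: `HistoryTailLaneNumerator.budget_of_c` (collar cost absorbed, from the landed v4
  `stub_budget`), `HistoryTailBoundedHeight.perPlaquette_of_split` (heights `j ≤ j₀` are a theorem), `HistoryTailBirthV3b.stub_tailOfPerPlaquette`
  (union bound and profile); block sizes that no `T3Family` has are vacuous.
* `averagedTailPkg_of_intCoreRec` — the socket of record instantiated: `(∀ L, Odd L → 1 < L → AlphaInputsT3AC.IntCoreRec L) → AvgTailPkg`
  (the lane records feed it through the tree's `intCoreRec_of_laneRecords` / `intCoreRec_of_laneRecordsChi`).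

WHAT THIS IS NOT: not a proof of `AvgTailPkg` (conditional on the K2 sockets, which are OPEN), not w2's bridge, not the crux; no summit
statement is touched (the line bears on the record rung R3, not on `YangMills`).
-/

noncomputable section

open MeasureTheory Filter Topology
open Literature.MathematicalPhysics.QuantumFieldTheory
open Literature.MathematicalPhysics.QuantumFieldTheory.Balaban1983to89
open Literature.MathematicalPhysics.QuantumFieldTheory.Balaban1983to89.Missing
open Literature.MathematicalPhysics.QuantumFieldTheory.Balaban1983to89.T3ContinuumYM3Torus
open Literature.MathematicalPhysics.QuantumFieldTheory.Balaban1983to89.T3UnitScaleTilt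
open Literature.MathematicalPhysics.QuantumFieldTheory.Balaban1983to89.T3UnitLawDensityEML
open Literature.MathematicalPhysics.QuantumFieldTheory.Balaban1983to89.T3BareTailProfile
open Literature.MathematicalPhysics.QuantumFieldTheory.Balaban1983to89.T3ThresholdSmallness (sqrt_coupling_pos_le)
open Literature.MathematicalPhysics.QuantumFieldTheory.Balaban1983to89.T3Thresholds (coupling_le_one)
open Literature.MathematicalPhysics.QuantumFieldTheory.Balaban1983to89.T3AlphaInputsAC
open Summit.QuantumFields.YangMills.Theorems
open Summit.QuantumFields.YangMills.Theorems.HistoryTailLaneNumerator (budget_of_c)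
open Summit.QuantumFields.YangMills.Theorems.HistoryTailLaneTailInt (perPlaquetteHighL_of_intCoreRec)

namespace Summit.QuantumFields.YangMills.Theorems.LargeFieldMassRefinementTail

/-- **THE AVERAGED-HEIGHT TAIL PACKAGE FROM THE THRESHOLD-FORM PER-PLAQUETTE HIGH TAIL.**  If for every odd block size `L > 1` and all
thresholds `(b₁, p₁)` there are a Bałaban profile `(b₀, p₀)` beyond them, collar exponents `r₀, κ ≥ 0` with `1 + 3r₀/2 < p₀`, a small-factor
constant `0 < c ≤ ¼` and a coupling threshold `0 < γ₁ ≤ 1` such that every family with `F.L = L` and every `0 < γ ≤ γ₁` admit a height `j₀`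
and constants `C ≥ 0`, `A` with `Gibbs_K{θ(K−j) ≤ |Ū^{j}(∂p) − 1|} ≤ C·β_{K−j}^A·exp(−c·p(g_{K−j})² + κ·(1 + log g_{K−j}⁻¹)^{2+3r₀})` for all
`K`, all `j₀ < j ≤ K` and all plaquettes `p` of `T^{(j)}_K`, then for EVERY `L` there are `b₀ > 0`, `p₀ > 2`, `0 < γ₁ ≤ 1` with
`AveragedTailAt F γ b₀ p₀` for every family with `F.L = L` and every `0 < γ ≤ γ₁` (collar budget, bounded heights, union bound — all
tree theorems of the K2 programme). [cite: Balaban1985UV3, (7) p.257 and (71) p.273] -/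
theorem averagedTailPkg_of_perPlaquetteHighL
    (hhighL : ∀ (L : ℕ), Odd L → 1 < L → ∀ (b₁ p₁ : ℝ),
      ∃ b₀ p₀ r₀ κ c : ℝ, b₁ ≤ b₀ ∧ p₁ ≤ p₀ ∧ 0 < b₀ ∧ 2 < p₀ ∧ 0 ≤ r₀ ∧ 0 ≤ κ ∧ 1 + 3 * r₀ / 2 < p₀ ∧ 0 < c ∧ c ≤ 1 / 4 ∧
        ∃ γ₁ : ℝ, 0 < γ₁ ∧ γ₁ ≤ 1 ∧
          ∀ (F : T3Family) (γ : ℝ), F.L = L → 0 < γ → γ ≤ γ₁ →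
            ∃ (j₀ : ℕ) (C : ℝ) (A : ℕ), 0 ≤ C ∧
              ∀ (K j : ℕ), j₀ < j → j ≤ K → ∀ p : Plaq (F.P K) j,
                (gibbsK F ℰp γ K).real
                    {U | θBal F.L γ b₀ p₀ (K - j) ≤
                      GaugeGroup.dist1 (GaugeField.plaqHol
                        (Averaging.iter (fun _ => BlockAveraging.blockAvg ℰp) j U) p)} ≤
                  C * (F.scheme ℰp γ).β (K - j) ^ A *
                    Real.exp (-(c * B10.pFun b₀ p₀ (Real.sqrt (γ * ((F.L : ℝ)⁻¹) ^ (K - j))) ^ 2) +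
                      κ * (1 + Real.log (Real.sqrt (γ * ((F.L : ℝ)⁻¹) ^ (K - j)))⁻¹) ^ (2 + 3 * r₀))) :
    ∀ L : ℕ, ∃ b₀ p₀ γ₁ : ℝ, 0 < b₀ ∧ 2 < p₀ ∧ 0 < γ₁ ∧ γ₁ ≤ 1 ∧
      ∀ (F : T3Family) (γ : ℝ), F.L = L → 0 < γ → γ ≤ γ₁ → AveragedTailAt F γ b₀ p₀ := by
  intro L
  by_cases hL : Odd L ∧ 1 < L
  · obtain ⟨b₀, p₀, r₀, κ, cSF, -, -, hb, hp2, hr₀, hκ, hp, hc0, -, γ₁, hγ₁, hγ₁1, h⟩ := hhighL L hL.1 hL.2 1 3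
    obtain ⟨C₆, c, hC₆, hc, hbud⟩ := budget_of_c b₀ p₀ r₀ κ cSF hb hr₀ hκ hp hc0
    refine ⟨b₀, p₀, γ₁, hb, hp2, hγ₁, hγ₁1, fun F γ hFL hγ hle => ?_⟩
    have hγ1 : γ ≤ 1 := hle.trans hγ₁1
    have hp01 : (1 : ℝ) ≤ p₀ := by linarith
    have hL1 : 1 ≤ F.L := F.hL.2.le
    obtain ⟨j₀, C, A, hC, hhigh⟩ := h F γ hFL hγ hle
    have hhigh' : ∃ (C : ℝ) (A : ℕ) (c : ℝ), 0 ≤ C ∧ 0 < c ∧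
        ∀ (K j : ℕ), j₀ < j → j ≤ K → ∀ p : Plaq (F.P K) j,
          (gibbsK F ℰp γ K).real
              {U | θBal F.L γ b₀ p₀ (K - j) ≤
                GaugeGroup.dist1 (GaugeField.plaqHol
                  (Averaging.iter (fun _ => BlockAveraging.blockAvg ℰp) j U) p)} ≤
            C * (F.scheme ℰp γ).β (K - j) ^ A *
              Real.exp (-(c * B10.pFun b₀ p₀ (Real.sqrt (γ * ((F.L : ℝ)⁻¹) ^ (K - j))) ^ 2)) := by
      refine ⟨C * C₆, A, c, mul_nonneg hC hC₆, hc, fun K j hj hjK p => ?_⟩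
      have hg := sqrt_coupling_pos_le hL1 hγ (K - j)
      have hg1 := coupling_le_one hL1 hγ hγ1 (K - j)
      have hβA : 0 ≤ C * (F.scheme ℰp γ).β (K - j) ^ A :=
        mul_nonneg hC (pow_nonneg (F.scheme_β_nonneg ℰp hγ.le (K - j)) A)
      calc (gibbsK F ℰp γ K).real
              {U | θBal F.L γ b₀ p₀ (K - j) ≤
                GaugeGroup.dist1 (GaugeField.plaqHol
                  (Averaging.iter (fun _ => BlockAveraging.blockAvg ℰp) j U) p)}
            ≤ C * (F.scheme ℰp γ).β (K - j) ^ A *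
                Real.exp (-(cSF * B10.pFun b₀ p₀ (Real.sqrt (γ * ((F.L : ℝ)⁻¹) ^ (K - j))) ^ 2) +
                  κ * (1 + Real.log (Real.sqrt (γ * ((F.L : ℝ)⁻¹) ^ (K - j)))⁻¹) ^ (2 + 3 * r₀)) := hhigh K j hj hjK p
        _ ≤ C * (F.scheme ℰp γ).β (K - j) ^ A *
                (C₆ * Real.exp (-(c * B10.pFun b₀ p₀ (Real.sqrt (γ * ((F.L : ℝ)⁻¹) ^ (K - j))) ^ 2))) :=
              mul_le_mul_of_nonneg_left (hbud _ hg.1 hg1) hβA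
        _ = C * C₆ * (F.scheme ℰp γ).β (K - j) ^ A *
                Real.exp (-(c * B10.pFun b₀ p₀ (Real.sqrt (γ * ((F.L : ℝ)⁻¹) ^ (K - j))) ^ 2)) := by ring
    have hPP := HistoryTailBoundedHeight.perPlaquette_of_split j₀ F hγ hγ1 hb.le p₀ hhigh'
    exact HistoryTailBirthV3b.stub_tailOfPerPlaquette F γ b₀ p₀ hγ hγ1 hb hp01 hPP
  · refine ⟨1, 3, 1, one_pos, by norm_num, one_pos, le_rfl, fun F γ hFL _ _ => ?_⟩
    have hF := F.hL
    rw [hFL] at hF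
    exact (hL hF).elim

/-- **`AvgTailPkg ⇐ IntCoreRec`**: the record-free interior socket of the K2-L line (`HistoryTailLaneTailInt.perPlaquetteHighL_of_intCoreRec`,
the hypothesis of the landed `historyTailL_of_intCoreRec`) gives the averaged-height tail package for every block size.
[cite: Balaban1985UV3, (5) p.256 and (71) p.273] -/
theorem averagedTailPkg_of_intCoreRec (hrec : ∀ L : ℕ, Odd L → 1 < L → AlphaInputsT3AC.IntCoreRec L) :
    ∀ L : ℕ, ∃ b₀ p₀ γ₁ : ℝ, 0 < b₀ ∧ 2 < p₀ ∧ 0 < γ₁ ∧ γ₁ ≤ 1 ∧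
      ∀ (F : T3Family) (γ : ℝ), F.L = L → 0 < γ → γ ≤ γ₁ → AveragedTailAt F γ b₀ p₀ :=
  averagedTailPkg_of_perPlaquetteHighL (perPlaquetteHighL_of_intCoreRec hrec)

end Summit.QuantumFields.YangMills.Theorems.LargeFieldMassRefinementTail

end
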